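import Summits.BirchSwinnertonDyer.Rank1Residual.X1.RankOneTamagawaSqueeze
import Summits.BirchSwinnertonDyer.Rank1Residual.X1.TamagawaSqueezeCited
import HarnessLib

/-!
# Route T at RANK ONE on class X1, LAYER 0, CITED: Kundu–Ray's printed generator bound
# `λ + μ ≥ #{ℓ : p ∣ c_ℓ} + 1` (no Mordell–Weil rank hypothesis) + the odd-parity squeeze ⇒ Mazur's
# main conjecture at a rank-one leaf pair WITHOUT rational `p`-torsion; + the Schneider certificate ⇒ `BSD(E,p)`

HONEST FRAMING (cell `b2b-bsdres`, run/shared/lean/b2b/bsd-rank1-residual/, verbatim in every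
file): the goal of the cell is to DELETE the COMBINATION-SHAPED residual classes of the
Birch–Swinnerton-Dyer formula for ALL analytic-rank `≤ 1` elliptic curves over `ℚ` — "full BSD
formula for every rank `≤ 1` curve in class `C`" assembled STRICTLY from published theorems — so
that the rank-`≤ 1` remainder becomes exactly the CONSTRUCTION-SHAPED classes, which are TYPED
(missing-input `Prop`s), NOT attempted. This is not "finishing BSD". Unit `b2b-bsdres-x1a`
(class-level owner of X1 (r = 1)), gen 12: research route; NO CLAIM BEYOND STATED CLASSES; nothing
here changes a label. No `def`, no new named fact; every theorem is a composition of PUBLISHED named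
facts (taken as displayed hypotheses) with the cell's typed per-pair ANALYTIC inputs
(`AnalyticMuLE`, `AnalyticLambdaEq`) and finite integer data.

WHY THIS FILE. Route T at rank one (`X1/RankOneTamagawaSqueeze.lean`, p219066) closes Mazur's main
conjecture at a rank-one leaf pair from `μ-part ∧ λ_an = n ∧ λ_alg ≥ k ∧ n ≤ k + 1` with the typed
input `AlgebraicLambdaGE W p k`, supplied per pair OUTSIDE the kernel (HOME/b2b-bsdres-x1a/gen12/
ROUTE-T-R1-PROOF.md: `λ_alg ≥ t_m + a − 2δ − p^m μ + GAIN`, where the Mordell–Weil corank CANCELS in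
Greenberg's control argument — Prop. 4.13 of LNM 1716 is the printed form of that step). eisenstein-p1
(gen 7, `X1/TamagawaSqueezeCited.lean`) observed that the LAYER-0 case at a member WITHOUT rational
`p`-torsion is a PRINTED lemma: Kundu–Ray, IJNT 20 (2024) Lemma 6.3 (with Def. 6.2, Lemma 2.1),
`λ_p + μ_p ≥ #{ℓ ≠ p : p ∣ c_ℓ(E)} + [p ∣ #Ẽ(𝔽_p)]` for `E/ℚ` good ordinary at odd `p`, `E(ℚ)[p] = 0`,
`Ш(E/ℚ)[p^∞]` finite — tree fact `KunduRay2024.lem63_card_add_anomalous_le_lambda_add_mu` (p209xxx,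
referee R106.3: page-read, PASS). The printed lemma carries NO hypothesis on the Mordell–Weil rank —
the rank-free shape this unit's memo proves in general — so it supplies route T at RANK ONE too. This
file is the rank-one twin of `TamagawaSqueezeCited`: on the leaf X1 ∩ {r = 1} the parity is ODD
(Selmer corank `1`, Greenberg Prop. 3.10; `λ_an` odd by Mazur–Tate–Teitelbaum, x1b's
`RankOne.Leaf.odd_of_analyticLambdaEq`), so `λ_alg ≥ #S + 1` closes the λ-part whenever
`λ_an ≤ #S + 2` (`λ_an = 3` needs ONE Tamagawa prime with `p ∣ c_ℓ`, `λ_an = 5` needs three; at rank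
zero `λ_an = 2` needed none).

* `lambdaPartAt_of_tamagawaPrimes_of_odd` — `p ≠ 2` good ordinary anomalous, `E[p]` reducible,
  `#E(ℚ)[p^∞] = 1`, `Ш(E/ℚ)` finite, `corank Sel_{p^∞}(E/ℚ) = 1`, `μ_an = 0`, `λ_an = n` odd,
  `S` a finite set of primes `ℓ ≠ p` with `p ∣ c_ℓ(E)`, `n ≤ #S + 2` ⇒ the λ-part `LambdaPartAt W p`;
  `mazurMainConjecture_of_tamagawaPrimes_of_odd` — with the μ-part (automatic at `μ_an = 0`).
* `RankOne.Leaf.mazurMainConjecture_of_muZero_of_tamagawaPrimes` — on the leaf (ClassX1 ∧ r_an = 1,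
  either Greenberg–Vatsal type): `#E(ℚ)[p^∞] = 1 ∧ μ_an = 0 ∧ λ_an = n ∧ n ≤ #S + 2 ⇒ MC` —
  Kundu–Ray 6.3 + Wuthrich 16 + Greenberg 3.10 + MTT parity + GZK, ALL PUBLISHED, plus the integers.
* `…_and_bsdp_…_of_coeff_one_ne_zero` / `…_of_le_norm_coeff_one` — + the Schneider certificate
  `[T¹]L_p(f,α) ≠ 0` (in the finite-precision currency a modular-symbol engine certifies) ⇒
  `MC ∧ BSD(E,p)`, no `#Ш(E/ℚ)_an` input (x1a p209819/p219066 converters).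
Reach (HOME/b2b-bsdres-x1a/gen12/ROUTE-T-R1-GAIN.md, census of rank-one X1 classes `N < 5·10⁵` with a
`δ = 0`, `μ_an = 0` member and `λ_an ≤ #S + 2`): `p = 3`: 116 type-A + 1 527 type-B classes; `p = 5`:
9 + 212; `p = 7`: 10 + 45; `p = 13`: 1 + 8 — every one already closed per pair by a typed-input
route (P₃/G/T); what changes is that the λ-lower bound is now CITED, not typed. Nothing is booked; the
X1 (r = 1) class-level status is unchanged (A1: KY 3.0.11 + 7.0.6 PRE + Schneider; B1: Schneider).

Flag echo (x1a gen 13; referee-2 gen 47 note `x1a-r1squeeze-KR24-flag`, nit `KR24-arxiv-numbering`):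
the Kundu–Ray fact `KunduRay2024.lem63_card_add_anomalous_le_lambda_add_mu` consumed here (binder
`hKR`) is transcribed in the arXiv v2 NUMBERING of arXiv:2106.12095 (Lemma 2.1 / Def. 6.2 / Lemma 6.3;
`-- TODO(journal numbering)` in `Literature/…/KunduRay2024/TamagawaGeneratorBound.lean`: the journal copy
IJNT 20 (2024) 1099–1124, acq-09079, was fulfilled with the arXiv text); the statement is unaffected, the
theorem numbers below are the arXiv ones until the journal pagination is read. Docstring-only addition;
declarations unchanged.

References: [KunduRay2024] Lemma 2.1, Def. 6.2, Lemma 6.3; [GreenbergLNM1716] Prop. 3.10, Prop. 4.13;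
[Wuthrich2014] Thm. 16; [MazurTateTeitelbaum1986Invent] §I.17–18; [PerrinRiou1987] §1.4;
HOME/b2b-bsdres-x1a/gen12/ROUTE-T-R1-PROOF.md, ROUTE-T-R1-GAIN.md.
-/

noncomputable section

open scoped Classical MatrixGroups ModularForm

open PowerSeries CongruenceSubgroup WeierstrassCurve Literature.NumberTheory.EllipticCurves
  Literature.NumberTheory.EllipticCurves.ModularForms
  Literature.NumberTheory.EllipticCurves.Wuthrich2014
  Literature.NumberTheory.EllipticCurves.Rank1Residual
  Literature.NumberTheory.EllipticCurves.Greenberg1999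
  Literature.NumberTheory.EllipticCurves.KunduRay2024
  Summit.BirchSwinnertonDyer.BirchSwinnertonDyer.Theorems
  Summit.BirchSwinnertonDyer.BirchSwinnertonDyer.Theorems.Rank1ResidualX1Defs
  Summit.BirchSwinnertonDyer.Rank1Residual.X1.MuLambda
  Summit.BirchSwinnertonDyer.Rank1Residual.X1.MuPart
  Summit.BirchSwinnertonDyer.Rank1Residual.X1.ParitySqueeze
  Summit.BirchSwinnertonDyer.Rank1Residual.X1.TamagawaSqueeze
  Summit.BirchSwinnertonDyer.Rank1Residual.X1.TamagawaSqueezeCited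

set_option autoImplicit false

namespace Summit.BirchSwinnertonDyer.Rank1Residual.X1.RankOneTamagawaSqueezeCited

/-! ## §1. The cited bound with the ODD-parity squeeze (Selmer corank `1`) -/

section Squeeze

variable {W : WeierstrassCurve ℚ} [W.IsElliptic] [W.IsGloballyMinimal] {p : ℕ} [Fact p.Prime]

/-- **Route T at layer 0, cited — λ-part with ODD parity.** `W/ℚ` globally minimal elliptic, `p ≠ 2`
good ordinary ANOMALOUS (`p ∣ #Ẽ(𝔽_p)`) with `E[p]` reducible, `#E(ℚ)[p^∞] = 1`, `Ш(E/ℚ)` finite,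
`corank_{ℤ_p} Sel_{p^∞}(E/ℚ) = 1` (`hcork`), `μ_an(E,p) = 0` (`AnalyticMuLE W p 0`), and `S` a finite
set of primes `ℓ ≠ p` with `p ∣ c_ℓ(E)`; granted Kundu–Ray 2024 Lemma 6.3 (`hKR`: `λ + μ ≥ #S + 1`, NO
rank hypothesis in print), Wuthrich 2014 Thm. 16 (`hW16`) and Greenberg's Prop. 3.10 (`h310`), all
PUBLISHED: if `λ_an(E,p) = n` is ODD and `n ≤ #S + 2`, the λ-part `LambdaPartAt W p` holds —
`λ(f_E) = λ(X) ≥ #S + 1 ≥ n − 1` (`TamagawaSqueezeCited.card_succ_le_lambdaInvariant`) is odd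
(Prop. 3.10 at corank `1`), `λ(f_E·h) = n` is odd, so `λ(h)` is even and `≤ 1`, hence `0`.
[cite: KunduRay2024, Lemma 6.3] [cite: GreenbergLNM1716, Prop. 3.10] [cite: Wuthrich2014, Thm. 16 (p. 397)] -/
theorem lambdaPartAt_of_tamagawaPrimes_of_odd (hKR : lem63_card_add_anomalous_le_lambda_add_mu)
    (hW16 : Wuthrich2014.charIdeal_dvd_padicLFunction)
    (h310 : prop310_selmerCorank_mod_two_eq_lambdaInvariant)
    (hmod : nonempty_modularParametrizationData)
    (hp : p ≠ 2) (hgood : W.HasGoodReductionAtPrime p) (hord : ¬ (p : ℤ) ∣ W.frobeniusTrace p)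
    (hred : ¬ W.HasIrreducibleModPGaloisRep p) (hanom : p ∣ W.reductionPointCount p)
    (htors : Nat.card (AddCommGroup.primaryComponent W.toAffine.Point p) = 1)
    (hsha : Finite W.sha) (hcork : W.selmerCorank p = 1) (hμ : AnalyticMuLE W p 0)
    {S : Finset ℕ} (hS : ∀ ℓ ∈ S, ℓ ≠ p ∧ PDvdTamagawaAt W p ℓ)
    {n : ℕ} (hn : Odd n) (hlam : AnalyticLambdaEq W p n) (hnS : n ≤ S.card + 2) :
    LambdaPartAt W p := by
  intro κ γ hκ hγ hγ' _ f hf ϖ hϖ D g h hchar hι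
  haveI : Module.Finite (IwasawaAlgebra p) D.X := D.module_finite_holds hγ
  obtain ⟨hX, h3⟩ := TamagawaSqueezeCited.card_succ_le_lambdaInvariant hKR hW16 hmod hp hgood hord
    hred hanom htors hsha hμ hS hκ hγ hγ' D
  have hgh : g * h ≠ 0 := mul_ne_zero_of_iota_eq hgood hord hf hϖ D hι
  have hg : g ≠ 0 := fun h0 ↦ hgh (by rw [h0, zero_mul])
  have hh : h ≠ 0 := fun h0 ↦ hgh (by rw [h0, mul_zero])
  have h1 : lam (g * h) = n := hlam f hf ϖ hϖ (g * h) hι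
  have h2 : lam g = lambdaInvariant p D.X := lam_generator_eq_lambdaInvariant D.X hX hg hchar
  have hodd : Odd (lam g) := by
    rw [h2]
    exact prop310_selmerCorank_mod_two_eq_lambdaInvariant.odd_lambdaInvariant_of_selmerCorank_eq_one
      h310 W p hp hκ hγ D hX hcork
  have hgh2 : Odd (lam (g * h)) := by rw [h1]; exact hn
  rw [lam_mul hg hh] at h1 hgh2 ⊢
  obtain ⟨a, ha⟩ := hodd
  obtain ⟨b, hb⟩ := hgh2
  omega

/-- **Route T at layer 0, cited, ODD parity — Mazur's main conjecture** (μ-part automatic at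
`μ_an = 0`, `MuPart.muPartAt_of_analyticMuLE_zero`; λ-part `lambdaPartAt_of_tamagawaPrimes_of_odd`).
[cite: KunduRay2024, Lemma 6.3] [cite: GreenbergLNM1716, Prop. 3.10] [cite: Wuthrich2014, Thm. 16 (p. 397)] -/
theorem mazurMainConjecture_of_tamagawaPrimes_of_odd
    (hKR : lem63_card_add_anomalous_le_lambda_add_mu)
    (hW16 : Wuthrich2014.charIdeal_dvd_padicLFunction)
    (h310 : prop310_selmerCorank_mod_two_eq_lambdaInvariant)
    (hmod : nonempty_modularParametrizationData)
    (hp : p ≠ 2) (hgood : W.HasGoodReductionAtPrime p) (hord : ¬ (p : ℤ) ∣ W.frobeniusTrace p)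
    (hred : ¬ W.HasIrreducibleModPGaloisRep p) (hanom : p ∣ W.reductionPointCount p)
    (htors : Nat.card (AddCommGroup.primaryComponent W.toAffine.Point p) = 1)
    (hsha : Finite W.sha) (hcork : W.selmerCorank p = 1) (hμ : AnalyticMuLE W p 0)
    {S : Finset ℕ} (hS : ∀ ℓ ∈ S, ℓ ≠ p ∧ PDvdTamagawaAt W p ℓ)
    {n : ℕ} (hn : Odd n) (hlam : AnalyticLambdaEq W p n) (hnS : n ≤ S.card + 2) :
    MazurMainConjecture W p :=
  (mazurMainConjecture_iff_muPart_and_lambdaPart hW16 hp hgood hord hred).mpr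
    ⟨muPartAt_of_analyticMuLE_zero hW16 hp hgood hord hred hμ,
      lambdaPartAt_of_tamagawaPrimes_of_odd hKR hW16 h310 hmod hp hgood hord hred hanom htors hsha
        hcork hμ hS hn hlam hnS⟩

end Squeeze

/-! ## §2. On the rank-one leaf X1 ∩ {r = 1} -/

section Leaf

variable {W : WeierstrassCurve ℚ} [W.IsElliptic] [W.IsGloballyMinimal] {p : ℕ} [Fact p.Prime]

omit [W.IsElliptic] in
/-- On the rank-one leaf `p ∣ #Ẽ(𝔽_p)` (the pair is anomalous: `a_p ≡ 1 (mod p)` and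
`#Ẽ(𝔽_p) = p + 1 − a_p`). [folklore] -/
theorem Leaf.dvd_reductionPointCount (hL : RankOne.Leaf W p) : p ∣ W.reductionPointCount p :=
  (dvd_reductionPointCount_iff_dvd_frobeniusTrace_sub_one W p).mpr
    (isClassX1_of_classX1 hL.1).dvd_frobeniusTrace_sub_one

/-- **Route T at layer 0, CITED, on the rank-one leaf — Mazur's main conjecture.** `W/ℚ` globally
minimal elliptic on the leaf X1 ∩ {r = 1} at `p` (either Greenberg–Vatsal type), with NO rational
`p`-power torsion (`#E(ℚ)[p^∞] = 1` — a `δ = 0` member), `μ_an(E,p) = 0`, `λ_an(E,p) = n`, and a finite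
set `S` of primes `ℓ ≠ p` with `p ∣ c_ℓ(E)` such that `n ≤ #S + 2`: then Mazur's main conjecture holds at
`(E, p)`. Inputs: Kundu–Ray 2024 Lemma 6.3 (`λ + μ ≥ #S + 1`; printed WITHOUT a rank hypothesis),
Kato–Wuthrich (`μ = 0` from `μ_an = 0`; torsion; `MC ⟺ μ-part ∧ λ-part`), Greenberg Prop. 3.10 (parity
at Selmer corank `1`, `RankOne.Leaf.selmerCorank_eq_one`), Mazur–Tate–Teitelbaum (`λ_an` odd on the
leaf, `RankOne.Leaf.odd_of_analyticLambdaEq`), Gross–Zagier–Kolyvagin (`Ш(E/ℚ)` finite, rank `1`) — ALL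
PUBLISHED; the certificates are the integers `n`, `#S` and `μ_an = 0`. First case: `λ_an = 3` with ONE
Tamagawa prime `p ∣ c_ℓ` (e.g. the 116 type-A rank-one X1 classes at `p = 3`, `N < 5·10⁵`, of
HOME/b2b-bsdres-x1a/gen12/ROUTE-T-R1-GAIN.md). [cite: KunduRay2024, Lemma 6.3]
[cite: GreenbergLNM1716, Prop. 3.10] [cite: Wuthrich2014, Thm. 16 (p. 397)]
[cite: MazurTateTeitelbaum1986Invent, §I.17–I.18] -/
theorem _root_.Summit.BirchSwinnertonDyer.Rank1Residual.X1.RankOne.Leaf.mazurMainConjecture_of_muZero_of_tamagawaPrimes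
    (hKR : lem63_card_add_anomalous_le_lambda_add_mu)
    (hW16 : Wuthrich2014.charIdeal_dvd_padicLFunction)
    (h310 : prop310_selmerCorank_mod_two_eq_lambdaInvariant)
    (hmod : nonempty_modularParametrizationData)
    (hGZK : rank_eq_analyticRank_of_analyticRank_le_one) (hL : RankOne.Leaf W p)
    (htors : Nat.card (AddCommGroup.primaryComponent W.toAffine.Point p) = 1)
    (hμ0 : AnalyticMuLE W p 0) {S : Finset ℕ} (hS : ∀ ℓ ∈ S, ℓ ≠ p ∧ PDvdTamagawaAt W p ℓ)
    {n : ℕ} (hlam : AnalyticLambdaEq W p n) (hnS : n ≤ S.card + 2) : MazurMainConjecture W p :=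
  have hX := isClassX1_of_classX1 hL.1
  mazurMainConjecture_of_tamagawaPrimes_of_odd hKR hW16 h310 hmod hX.two_ne hX.hasGoodReductionAtPrime
    hX.not_dvd_frobeniusTrace hX.not_hasIrreducibleModPGaloisRep (Leaf.dvd_reductionPointCount hL) htors
    (hGZK W hL.analyticRank_eq_one.le).2 (hL.selmerCorank_eq_one hGZK) hμ0 hS
    (hL.odd_of_analyticLambdaEq hW16 hmod hlam) hlam hnS

/-- **Route T at layer 0, CITED, in certificate currency: `#E(ℚ)[p^∞] = 1 ∧ μ_an = 0 ∧ λ_an = n ∧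
n ≤ #S + 2` + `[T¹]L_p(f,α,T) ≠ 0` (for SOME newform `f` of `E`) ⇒ Mazur's MC ∧ `BSD(E,p)`** on the
rank-one leaf (x1a's `RankOne.Leaf.bsdp_of_mazurMainConjecture_of_schneider` through the converter
`RankOne.Leaf.schneider_of_coeff_one_ne_zero`: Perrin-Riou–Schneider, Perrin-Riou 1987, Mazur–Tate σ,
modularity, GZK — PUBLISHED). No `#Ш(E/ℚ)_an`, no height computation, no typed λ-input.
[cite: KunduRay2024, Lemma 6.3] [cite: GreenbergLNM1716, Prop. 3.10] [cite: Wuthrich2014, Thm. 16 (p. 397)]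
[cite: BalakrishnanMullerStein2015, Thm. 1.7] [cite: PerrinRiou1987, §1.4 Cor. 1.8] -/
theorem _root_.Summit.BirchSwinnertonDyer.Rank1Residual.X1.RankOne.Leaf.mazurMainConjecture_and_bsdp_of_muZero_of_tamagawaPrimes_of_coeff_one_ne_zero
    (hKR : lem63_card_add_anomalous_le_lambda_add_mu)
    (hW16 : Wuthrich2014.charIdeal_dvd_padicLFunction)
    (h310 : prop310_selmerCorank_mod_two_eq_lambdaInvariant)
    (hS : Schneider1985_order_charGenerator_odd) (hPR : perrinRiou_rankOne_leadingTerms_odd)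
    (hMT : mazur_tate_sigma_exists_odd) (hmod : nonempty_modularParametrizationData)
    (hGZK : rank_eq_analyticRank_of_analyticRank_le_one) (hL : RankOne.Leaf W p)
    (htors : Nat.card (AddCommGroup.primaryComponent W.toAffine.Point p) = 1)
    (hμ0 : AnalyticMuLE W p 0) {T : Finset ℕ} (hT : ∀ ℓ ∈ T, ℓ ≠ p ∧ PDvdTamagawaAt W p ℓ)
    {n : ℕ} (hlam : AnalyticLambdaEq W p n) (hnT : n ≤ T.card + 2)
    {N : ℕ} [NeZero N] (f : CuspForm (Gamma0 N) 2) (hf : IsNewformOf W f)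
    (hcoeff : coeff 1 (padicLFunction f (unitRoot W p : ℚ_[p])) ≠ 0) :
    MazurMainConjecture W p ∧ BSDp W p :=
  have hMC : MazurMainConjecture W p :=
    hL.mazurMainConjecture_of_muZero_of_tamagawaPrimes hKR hW16 h310 hmod hGZK htors hμ0 hT hlam hnT
  ⟨hMC, hL.bsdp_of_mazurMainConjecture_of_schneider hS hPR hMT hmod hGZK
    (hL.schneider_of_coeff_one_ne_zero hPR hGZK f hf hcoeff) hMC⟩

/-- **Route T at layer 0, CITED — headline in the finite-precision currency a modular-symbol engine
certifies: `#E(ℚ)[p^∞] = 1 ∧ μ_an = 0 ∧ λ_an = n ∧ n ≤ #S + 2` + `p^{-v} ≤ ‖[T¹](ϖ·L_p(f,α))‖_p` ⇒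
Mazur's MC ∧ `BSD(E,p)`** on the rank-one leaf (x1a `RankOne.coeff_one_ne_zero_of_le_norm_coeff_one_smul`).
[cite: KunduRay2024, Lemma 6.3] [cite: GreenbergLNM1716, Prop. 3.10] [cite: Wuthrich2014, Thm. 16 (p. 397)]
[cite: PerrinRiou1987, §1.4 Cor. 1.8] [cite: SteinWuthrich2013, §§3–4, §9] -/
theorem _root_.Summit.BirchSwinnertonDyer.Rank1Residual.X1.RankOne.Leaf.mazurMainConjecture_and_bsdp_of_muZero_of_tamagawaPrimes_of_le_norm_coeff_one
    (hKR : lem63_card_add_anomalous_le_lambda_add_mu)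
    (hW16 : Wuthrich2014.charIdeal_dvd_padicLFunction)
    (h310 : prop310_selmerCorank_mod_two_eq_lambdaInvariant)
    (hS : Schneider1985_order_charGenerator_odd) (hPR : perrinRiou_rankOne_leadingTerms_odd)
    (hMT : mazur_tate_sigma_exists_odd) (hmod : nonempty_modularParametrizationData)
    (hGZK : rank_eq_analyticRank_of_analyticRank_le_one) (hL : RankOne.Leaf W p)
    (htors : Nat.card (AddCommGroup.primaryComponent W.toAffine.Point p) = 1)
    (hμ0 : AnalyticMuLE W p 0) {T : Finset ℕ} (hT : ∀ ℓ ∈ T, ℓ ≠ p ∧ PDvdTamagawaAt W p ℓ)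
    {n : ℕ} (hlam : AnalyticLambdaEq W p n) (hnT : n ≤ T.card + 2)
    {N : ℕ} [NeZero N] (f : CuspForm (Gamma0 N) 2) (hf : IsNewformOf W f) (ϖ : ℚ_[p]) (v : ℕ)
    (hcoeff : (p : ℝ) ^ (-(v : ℤ)) ≤ ‖coeff 1 (C ϖ * padicLFunction f (unitRoot W p : ℚ_[p]))‖) :
    MazurMainConjecture W p ∧ BSDp W p :=
  have hpP : p.Prime := Fact.out
  hL.mazurMainConjecture_and_bsdp_of_muZero_of_tamagawaPrimes_of_coeff_one_ne_zero hKR hW16 h310 hS hPR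
    hMT hmod hGZK htors hμ0 hT hlam hnT f hf
    (RankOne.coeff_one_ne_zero_of_le_norm_coeff_one_smul _ ϖ (zpow_pos (by exact_mod_cast hpP.pos) _)
      hcoeff)

/-- **`λ_an = 3` with ONE Tamagawa prime, cited**: on the rank-one leaf, `#E(ℚ)[p^∞] = 1 ∧ μ_an = 0 ∧
λ_an = 3` and a prime `ℓ ≠ p` with `p ∣ c_ℓ(E)` ⇒ Mazur's main conjecture (`S = {ℓ}`, `3 ≤ 1 + 2`).
[cite: KunduRay2024, Lemma 6.3] [cite: GreenbergLNM1716, Prop. 3.10] [cite: Wuthrich2014, Thm. 16 (p. 397)] -/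
theorem _root_.Summit.BirchSwinnertonDyer.Rank1Residual.X1.RankOne.Leaf.mazurMainConjecture_of_muZero_lamThree_of_pDvdTamagawaAt
    (hKR : lem63_card_add_anomalous_le_lambda_add_mu)
    (hW16 : Wuthrich2014.charIdeal_dvd_padicLFunction)
    (h310 : prop310_selmerCorank_mod_two_eq_lambdaInvariant)
    (hmod : nonempty_modularParametrizationData)
    (hGZK : rank_eq_analyticRank_of_analyticRank_le_one) (hL : RankOne.Leaf W p)
    (htors : Nat.card (AddCommGroup.primaryComponent W.toAffine.Point p) = 1)
    (hμ0 : AnalyticMuLE W p 0) (hlam3 : AnalyticLambdaEq W p 3) {ℓ : ℕ} (hℓp : ℓ ≠ p)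
    (hℓ : PDvdTamagawaAt W p ℓ) : MazurMainConjecture W p :=
  hL.mazurMainConjecture_of_muZero_of_tamagawaPrimes hKR hW16 h310 hmod hGZK htors hμ0 (S := {ℓ})
    (fun q hq ↦ by rw [Finset.mem_singleton] at hq; subst hq; exact ⟨hℓp, hℓ⟩) hlam3 (by simp)

end Leaf

end Summit.BirchSwinnertonDyer.Rank1Residual.X1.RankOneTamagawaSqueezeCited

end
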